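import Literature.NumberTheory.EllipticCurves.IsogenyPotentiallyGoodMinimalDiscriminantProofs
import Literature.NumberTheory.EllipticCurves.NeronIsogenyScalingProofs
import Literature.NumberTheory.EllipticCurves.VeluOddKernelProofs
import HarnessLib

/-!
# The orientation of the Néron scalar of an isogeny at a potentially good prime: the
# `φ^*ω'/ω` column of Dokchitser–Dokchitser 2015, Table 1 (= Gealy–Klagsbrun 2017, Thm. 1,
# clauses (ii)–(iii)), for EVERY prime and EVERY potentially good fibre — proofs only

`Proofs` file (theorems only: no definition, no named fact, no instance), topic
`NumberTheory/EllipticCurves`. Companion of `IsogenyPotentiallyGoodMinimalDiscriminantProofs.lean`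
(Dokchitser–Dokchitser 2015, Thm. 5.1 (1), clause `l ≠ p`, discharged there): the SAME argument —
"the multiplier of an isogeny into a model minimal at `w` is `w`-integral"
(`IsDedekindDomain.HeightOneSpectrum.valuation_multiplier_le_one`, the tree's substitute for the
Néron mapping property), read over a field where the curve has good reduction — is re-keyed on the
MULTIPLIER instead of the DEGREE:

* §1 `WeierstrassCurve.Isogeny.leadingCoeff_eq_of_x_formula` — **the multiplier of an isogeny is
  determined up to sign by the isogeny**: two `x`-formulas `x(φP) = A(x)/B(x)`, `= A'(x)/B'(x)`
  (`B, B'` monic, `deg A = deg B + 1`, valid off finite sets) have `lc A = lc A'`, i.e. equal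
  squared inverse multipliers (`AB' = A'B` as polynomials: they agree at the abscissae of all but
  finitely many `ℚ̄`-points).
* §2 `padicValInt_minimalDiscriminantInt_le_of_isogeny_of_not_dvd_multiplier` — **one-sided
  inequality, multiplier form**: a `ℚ`-isogeny `φ : W → W'` of globally minimal curves whose
  multiplier `k ∈ ℤ` is prime to `p`, read over `F ∋ w ∣ p` on `w`-minimal good-reduction models,
  gives `ord_p Δ_min(W) ≤ ord_p Δ_min(W')` (verbatim the proof of
  `padicValInt_minimalDiscriminantInt_le_of_isogeny_of_isMinimalAt`, whose hypothesis `p ∤ deg φ` was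
  used only to make `k` a `p`-unit).
* `valuation_j_le_one_of_padicValRat_j_nonneg` — `0 ≤ ord_p j` read at the place above `p`.

The sequel `IsogenyNeronScalarOrientationProofs.lean` turns §2 into the LATTICE form (an integral
Néron scaling prime to `p` does not lower `ord_p Δ_min` at a potentially good `p`) and the
orientation law (Dokchitser–Dokchitser Table 1, column `φ^*ω'/ω`; Gealy–Klagsbrun 2017 Thm. 1
(ii)–(iii) for every `p`, without the supersingularity hypothesis).

References: [DokchitserDokchitser2015LocalInvariants] T. Dokchitser, V. Dokchitser, *Local
invariants of isogenous elliptic curves*, Trans. AMS 367 (2015), Table 1 (column `φ^*ω'/ω`),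
Thm. 5.1; [GealyKlagsbrun2017] M. Gealy, Z. Klagsbrun, arXiv:1703.02148, Thm. 1;
[SilvermanAEC2009] Thm. VI.4.1(b), Prop. VII.5.5, Cor. VII.7.2; [SilvermanATAEC1994] IV.5.1, IV.6.1,
Cor. IV.9.1 (Néron mapping property), Prop. IV.10.3.
-/

noncomputable section

open scoped Classical

/-! ## §1 The multiplier is determined up to sign -/

namespace WeierstrassCurve

namespace Isogeny

open _root_.Polynomial

variable {W W' : WeierstrassCurve ℚ} [W.IsElliptic]

/-- **Two `x`-formulas of one isogeny have the same leading coefficient** (`AB' = A'B`): for a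
`ℚ`-isogeny `φ : W → W'` with `x(φP) = A(x)/B(x)` off a finite set `Bad` and `= A'(x)/B'(x)` off a
finite set `Bad'` (`B, B'` monic), `AB' = A'B`, so `lc A = lc A'`. The
multiplier `k` of `φ` on invariant differentials enters the `x`-formula as `lc A = k⁻²`
(Silverman *AEC* VI.4.1(b): `x ∘ φ = k⁻²x + O(1)`), so it is determined by `φ` up to sign.
[cite: SilvermanAEC2009, Thm. VI.4.1(b) and III.4] -/
theorem leadingCoeff_eq_of_x_formula (φ : Isogeny W W') {A B A' B' : ℚ[X]}
    {Bad Bad' : Set W.geomPoints} (hBad : Bad.Finite) (hBad' : Bad'.Finite)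
    (hBm : B.Monic) (hB'm : B'.Monic)
    (hform : ∀ (x y : AlgebraicClosure ℚ)
      (h : (W.baseChange (AlgebraicClosure ℚ)).toAffine.Nonsingular x y),
      (Affine.Point.some x y h : W.geomPoints) ∉ Bad →
      aeval x B ≠ 0 ∧ ∃ (y₂ : AlgebraicClosure ℚ)
        (h₂ : (W'.baseChange (AlgebraicClosure ℚ)).toAffine.Nonsingular (aeval x A / aeval x B) y₂),
        φ (Affine.Point.some x y h) = Affine.Point.some (aeval x A / aeval x B) y₂ h₂)
    (hform' : ∀ (x y : AlgebraicClosure ℚ)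
      (h : (W.baseChange (AlgebraicClosure ℚ)).toAffine.Nonsingular x y),
      (Affine.Point.some x y h : W.geomPoints) ∉ Bad' →
      aeval x B' ≠ 0 ∧ ∃ (y₂ : AlgebraicClosure ℚ)
        (h₂ : (W'.baseChange (AlgebraicClosure ℚ)).toAffine.Nonsingular (aeval x A' / aeval x B') y₂),
        φ (Affine.Point.some x y h) = Affine.Point.some (aeval x A' / aeval x B') y₂ h₂) :
    A.leadingCoeff = A'.leadingCoeff := by
  -- the exceptional abscissae: `x`-coordinates of the points of `Bad ∪ Bad'`
  set T : Set (AlgebraicClosure ℚ) :=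
    (fun P : (W.baseChange (AlgebraicClosure ℚ)).toAffine.Point ↦ Affine.Point.xOf P) ''
      (Bad ∪ Bad') with hT
  have hTfin : T.Finite := (hBad.union hBad').image _
  -- off `T`, the polynomial `A B' - A' B` vanishes
  set D : ℚ[X] := A * B' - A' * B with hD
  have hroot : ∀ x : AlgebraicClosure ℚ, x ∉ T → aeval x D = 0 := by
    intro x hx
    -- a point of `W(ℚ̄)` with abscissa `x`
    haveI : (W.baseChange (AlgebraicClosure ℚ)).IsElliptic :=
      inferInstanceAs (W.map (algebraMap ℚ (AlgebraicClosure ℚ))).IsElliptic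
    obtain ⟨y, hy⟩ := (W.baseChange (AlgebraicClosure ℚ)).exists_equation x
    have hns : (W.baseChange (AlgebraicClosure ℚ)).toAffine.Nonsingular x y :=
      Affine.equation_iff_nonsingular.mp hy
    have hP : (Affine.Point.some x y hns : W.geomPoints) ∉ Bad := fun h ↦
      hx ⟨Affine.Point.some x y hns, Or.inl h, rfl⟩
    have hP' : (Affine.Point.some x y hns : W.geomPoints) ∉ Bad' := fun h ↦
      hx ⟨Affine.Point.some x y hns, Or.inr h, rfl⟩
    obtain ⟨hB0, y₂, h₂, e₂⟩ := hform x y hns hP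
    obtain ⟨hB0', y₂', h₂', e₂'⟩ := hform' x y hns hP'
    rw [e₂] at e₂'
    have hx' : aeval x A / aeval x B = aeval x A' / aeval x B' := by
      injection e₂' with hx _
    rw [div_eq_div_iff hB0 hB0'] at hx'
    simp only [hD, map_sub, map_mul]
    rw [hx', mul_comm (aeval x A') (aeval x B)]
    ring
  have hD0 : D = 0 := by
    by_contra hne
    have hfin : Set.Finite {x : AlgebraicClosure ℚ | aeval x D = 0} := by
      have := (D.map (algebraMap ℚ (AlgebraicClosure ℚ))).rootSet_finite (AlgebraicClosure ℚ)
      refine (((D.map (algebraMap ℚ (AlgebraicClosure ℚ))).roots.toFinset.finite_toSet)).subset ?_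
      intro x hx
      simp only [Set.mem_setOf_eq] at hx
      simp only [Finset.mem_coe, Multiset.mem_toFinset]
      rw [mem_roots (by rwa [Ne, Polynomial.map_eq_zero]), IsRoot, eval_map_algebraMap]
      exact hx
    have hcof : (Tᶜ : Set (AlgebraicClosure ℚ)) ⊆ {x | aeval x D = 0} := fun x hx ↦ hroot x hx
    exact (Set.Finite.subset hfin hcof).not_infinite (Set.Finite.infinite_compl hTfin)
  -- leading coefficients
  have hAB : A * B' = A' * B := sub_eq_zero.mp (by rw [← hD]; exact hD0)
  have h1 := congrArg leadingCoeff hAB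
  rw [leadingCoeff_mul, leadingCoeff_mul, hB'm.leadingCoeff, hBm.leadingCoeff, mul_one,
    mul_one] at h1
  exact h1

end Isogeny

end WeierstrassCurve

/-! ## §2 The one-sided inequality, keyed on the multiplier -/

namespace Literature.NumberTheory.EllipticCurves

open _root_.WeierstrassCurve _root_.IsDedekindDomain _root_.NumberField _root_.Polynomial
  Literature.NumberTheory.GaloisRepresentations

section Valuation

variable {F : Type} [Field F] [NumberField F]

/-- At a place `w ∣ p`: `0 < w(p) < 1`. [folklore] -/
private theorem val_natCast_pos_lt_one (w : HeightOneSpectrum (𝓞 F)) {p : ℕ} (hp : p.Prime)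
    (hpw : (p : 𝓞 F) ∈ w.asIdeal) :
    0 < w.valuation F (p : F) ∧ w.valuation F (p : F) < 1 := by
  refine ⟨?_, ?_⟩
  · exact (Valuation.pos_iff _).mpr (by exact_mod_cast hp.ne_zero)
  · have : (p : F) = algebraMap (𝓞 F) F (p : 𝓞 F) := by simp
    rw [this, HeightOneSpectrum.valuation_lt_one_iff_mem]
    exact hpw

/-- At a place `w ∣ p`, a nonzero rational `q` with `ord_p q = m ∈ ℕ` has `w(q) = w(p)^m`.
[folklore] -/
private theorem val_ratCast_eq_pow (w : HeightOneSpectrum (𝓞 F)) {p : ℕ}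
    (hp : p.Prime) (hpw : (p : 𝓞 F) ∈ w.asIdeal) {q : ℚ} (hq : q ≠ 0) {m : ℕ}
    (hm : padicValRat p q = m) :
    w.valuation F (q : F) = w.valuation F (p : F) ^ m := by
  haveI := Fact.mk hp
  have hp0 : (p : ℚ) ≠ 0 := by exact_mod_cast hp.ne_zero
  have hq' : padicValRat p (q / (p : ℚ) ^ m) = 0 := by
    rw [padicValRat.div hq (pow_ne_zero _ hp0), padicValRat.pow, padicValRat.self hp.one_lt, hm,
      mul_one, sub_self]
  have h1 := valuation_ratCast_eq_one_of_padicValRat_eq_zero (v := w) hp hpw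
    (div_ne_zero hq (pow_ne_zero _ hp0)) hq'
  have : (q : F) = ((q / (p : ℚ) ^ m : ℚ) : F) * (p : F) ^ m := by
    have hpF0 : (p : F) ≠ 0 := by exact_mod_cast hp.ne_zero
    push_cast
    field_simp
  rw [this, map_mul, h1, one_mul, map_pow]

/-- **The `p`-adic valuation of the minimal discriminant read at a place `w ∣ p`**: for a globally
minimal `W/ℚ`, `w(Δ_min(W)) = w(p)^{ord_p Δ_min(W)}`. [folklore] -/
private theorem val_minimalDiscriminantInt (W : WeierstrassCurve ℚ) [W.IsElliptic]
    [W.IsGloballyMinimal] (w : HeightOneSpectrum (𝓞 F)) {p : ℕ} (hp : p.Prime)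
    (hpw : (p : 𝓞 F) ∈ w.asIdeal) :
    w.valuation F (W.Δ : F) =
      w.valuation F (p : F) ^ padicValInt p W.minimalDiscriminantInt := by
  have hΔ : (W.minimalDiscriminantInt : ℚ) = W.Δ := W.cast_minimalDiscriminantInt
  have hΔ0 : W.minimalDiscriminantInt ≠ 0 := W.minimalDiscriminantInt_ne_zero
  have hq : (W.Δ : ℚ) ≠ 0 := by rw [← hΔ]; exact_mod_cast hΔ0
  refine val_ratCast_eq_pow w hp hpw hq ?_
  rw [← hΔ, padicValRat.of_int]

end Valuation

section OneSided

/-- **One-sided Dokchitser–Dokchitser inequality, multiplier form.** Let `φ : W → W'` be a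
`ℚ`-isogeny between globally minimal elliptic curves with `x`-formula `x(φP) = A(x)/B(x)` off
`ker φ` (`B` monic, `deg A = deg B + 1`) whose multiplier `k ∈ ℤ` (`lc A = k⁻²`, i.e.
`φ^*ω' = ±kω` on the Néron differentials) is PRIME TO `p`; let `F ∋ w ∣ p` be a finite extension
(inside `ℚ̄`) and `C • W_F`, `C' • W'_F` models MINIMAL at `w` with `w`-unit discriminants. Then
`ord_p Δ_min(W) ≤ ord_p Δ_min(W')`: the transported isogeny has multiplier `k u'/u`, which is
`w`-integral (`valuation_multiplier_le_one`), so `w(u') ≤ w(u)` while `w(Δ_W) = w(u)¹²`,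
`w(Δ_{W'}) = w(u')¹²`. Verbatim the tree's `padicValInt_minimalDiscriminantInt_le_of_isogeny_of_isMinimalAt`
with «`p ∤ deg φ`» replaced by «`p ∤ k`» (the only use of the degree there).
[cite: DokchitserDokchitser2015LocalInvariants, Table 1 (column φ^*ω'/ω) and Thm. 5.1]
[cite: SilvermanATAEC1994, IV.5.1 with IV.6.1 and Cor. IV.9.1] -/
theorem padicValInt_minimalDiscriminantInt_le_of_isogeny_of_not_dvd_multiplier
    {W W' : WeierstrassCurve ℚ} [W.IsElliptic] [W'.IsElliptic] [W.IsGloballyMinimal]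
    [W'.IsGloballyMinimal] (φ : Isogeny W W') {p : ℕ} (hp : p.Prime) {k : ℤ} (hk0 : k ≠ 0)
    (hpk : ¬ (p : ℤ) ∣ k) {A B : ℚ[X]} (hBm : B.Monic) (hdeg : A.natDegree = B.natDegree + 1)
    (hlc : A.leadingCoeff = (k : ℚ)⁻¹ ^ 2)
    (hform : ∀ (x y : AlgebraicClosure ℚ)
      (h : (W.baseChange (AlgebraicClosure ℚ)).toAffine.Nonsingular x y),
      φ (Affine.Point.some x y h) ≠ 0 →
      aeval x B ≠ 0 ∧ ∃ (y₂ : AlgebraicClosure ℚ)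
        (h₂ : (W'.baseChange (AlgebraicClosure ℚ)).toAffine.Nonsingular (aeval x A / aeval x B) y₂),
        φ (Affine.Point.some x y h) = Affine.Point.some (aeval x A / aeval x B) y₂ h₂)
    (F : IntermediateField ℚ (AlgebraicClosure ℚ)) [FiniteDimensional ℚ F] [NumberField F]
    (w : HeightOneSpectrum (𝓞 F)) (hpw : (p : 𝓞 F) ∈ w.asIdeal) (C C' : VariableChange F)
    (hC : (C • W.baseChange F).IsMinimalAt w) (hC' : (C' • W'.baseChange F).IsMinimalAt w)
    (hΔ : w.valuation F (C • W.baseChange F).Δ = 1)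
    (hΔ' : w.valuation F (C' • W'.baseChange F).Δ = 1) :
    padicValInt p W.minimalDiscriminantInt ≤ padicValInt p W'.minimalDiscriminantInt := by
  classical
  haveI := Fact.mk hp
  haveI : (W.baseChange F).IsElliptic := inferInstanceAs (W.map (algebraMap ℚ F)).IsElliptic
  haveI : (W'.baseChange F).IsElliptic := inferInstanceAs (W'.map (algebraMap ℚ F)).IsElliptic
  have hwk : w.valuation F ((k : ℚ) : F) = 1 := by
    refine valuation_ratCast_eq_one_of_padicValRat_eq_zero (v := w) hp hpw
      (by exact_mod_cast hk0) ?_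
    rw [padicValRat.of_int, padicValInt.eq_zero_of_not_dvd hpk, Nat.cast_zero]
  -- the transported isogeny between the minimal models and its multiplier
  obtain ⟨Φ, A', B', Bad, hBad, hB'm, hdeg', hlc', hform'⟩ :=
    φ.exists_x_formula_smul_extendScalars hBm hdeg hlc hform F C C'
  haveI : ((C • W.baseChange F).baseChange (w.adicCompletion F)).IsMinimal
      (w.adicCompletionIntegers F) := hC
  haveI : ((C' • W'.baseChange F).baseChange (w.adicCompletion F)).IsMinimal
      (w.adicCompletionIntegers F) := hC'
  set c : F := algebraMap ℚ F k * (C'.u : F) * (C.u : F)⁻¹ with hc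
  have hkF : algebraMap ℚ F (k : ℚ) = ((k : ℚ) : F) := by rw [eq_ratCast]
  have hkF0 : algebraMap ℚ F (k : ℚ) ≠ 0 := by
    rw [hkF]; exact_mod_cast hk0
  have hc0 : c ≠ 0 := mul_ne_zero (mul_ne_zero hkF0 C'.u.ne_zero) (inv_ne_zero C.u.ne_zero)
  have hval : w.valuation F c ≤ 1 :=
    HeightOneSpectrum.valuation_multiplier_le_one w (C • W.baseChange F) (C' • W'.baseChange F)
      Φ hc0 hBad hB'm hdeg' hlc' hform'
  -- `w(u') ≤ w(u)`
  have hu0 : w.valuation F (C.u : F) ≠ 0 := (Valuation.ne_zero_iff _).mpr C.u.ne_zero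
  have hu'le : w.valuation F (C'.u : F) ≤ w.valuation F (C.u : F) := by
    rw [hc, map_mul, map_mul, map_inv₀, hkF, hwk, one_mul] at hval
    rwa [mul_inv_le_iff₀ (zero_lt_iff.mpr hu0), one_mul] at hval
  -- `w(Δ_W) = w(u)¹²`, `w(Δ_{W'}) = w(u')¹²`
  have hΔu : ∀ (V : WeierstrassCurve ℚ) (D : VariableChange F),
      w.valuation F (D • V.baseChange F).Δ = 1 →
      w.valuation F (V.Δ : F) = w.valuation F (D.u : F) ^ 12 := by
    intro V D h
    have hD0 : w.valuation F (D.u : F) ≠ 0 := (Valuation.ne_zero_iff _).mpr D.u.ne_zero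
    rw [variableChange_Δ, WeierstrassCurve.baseChange, map_Δ, eq_ratCast, map_mul, map_pow,
      Units.val_inv_eq_inv_val, map_inv₀] at h
    rwa [inv_pow, inv_mul_eq_one₀ (pow_ne_zero _ hD0), eq_comm] at h
  have h1 : w.valuation F (W'.Δ : F) ≤ w.valuation F (W.Δ : F) := by
    rw [hΔu W C hΔ, hΔu W' C' hΔ']
    exact pow_le_pow_left₀ zero_le hu'le 12
  -- translate to `ord_p`
  rw [val_minimalDiscriminantInt W w hp hpw, val_minimalDiscriminantInt W' w hp hpw] at h1
  obtain ⟨hp0, hp1⟩ := val_natCast_pos_lt_one w hp hpw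
  rwa [pow_le_pow_iff_right_of_lt_one₀ hp0 hp1] at h1

end OneSided

section JValuation

/-- **`0 ≤ ord_p j` read at the place of `ℚ` above `p`**: `v(j) ≤ 1` for
`v = primesEquiv.symm p` — the hypothesis «`j` integral at `p`» of Silverman *AEC* VII.5.5
(potentially good reduction) in the tree's place vocabulary.
[cite: SilvermanAEC2009, Prop. VII.5.5 (j integral at v ⟺ potentially good reduction at v)] -/
theorem valuation_j_le_one_of_padicValRat_j_nonneg (W : WeierstrassCurve ℚ) [W.IsElliptic] {p : ℕ}
    (hp : p.Prime)
    (hj : 0 ≤ padicValRat p W.j) :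
    ((Rat.HeightOneSpectrum.primesEquiv (R := 𝓞 ℚ)).symm ⟨p, hp⟩).valuation ℚ W.j ≤ 1 := by
  set v₀ : HeightOneSpectrum (𝓞 ℚ) := (Rat.HeightOneSpectrum.primesEquiv (R := 𝓞 ℚ)).symm ⟨p, hp⟩
    with hv₀
  have hpv₀ : (p : 𝓞 ℚ) ∈ v₀.asIdeal :=
    (natCast_mem_asIdeal_iff_eq_primesEquiv_symm v₀ hp).mpr hv₀
  by_cases hj0 : W.j = 0
  · rw [hj0, map_zero]; exact zero_le
  · obtain ⟨m, hm⟩ := Int.eq_ofNat_of_zero_le hj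
    have h := val_ratCast_eq_pow (F := ℚ) v₀ hp hpv₀ hj0 hm
    rw [Rat.cast_id] at h
    rw [h]
    exact pow_le_one₀ zero_le (val_natCast_pos_lt_one v₀ hp hpv₀).2.le

end JValuation

end Literature.NumberTheory.EllipticCurves

end
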